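import Literature.MathematicalPhysics.QuantumManyBody.GroundStateFeynmanKac
import Literature.MathematicalPhysics.QuantumFieldTheory.GaussianToolkit
import Literature.Probability.Distributions.GaussianSlabs
import HarnessLib

/-!
# Ground-state Feynman–Kac: the Gaussian law of the world-lines at a fixed time

Topic `Literature/MathematicalPhysics/QuantumManyBody`; theorems only (no new definition, no named
fact). Step of the proof of the named fact
`Literature.MathematicalPhysics.QuantumManyBody.BoseGas.GroundStateFeynmanKac`: the time-`t`
marginal of the `N` world-lines `B_t = X + √2 b_t` under `wienerPaths N` is the Gaussian
`N(X, 2t I_{3N})` on `(ℝ³)^N`, written as a density with respect to Lebesgue measure,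

  `law(B_t) = ∏_{i,k} N(X_{ik}, 2t)`,  i.e.  `(wienerPaths N).map (worldLine X · t) =
     volume.withDensity (Y ↦ ∏ i, ∏ k, gaussianPDF (X i k) (2t) (Y i k))`   (`map_worldLine`),

the free heat kernel `p(2t; X, Y)` of Chung–Zhao (1995), (1.11)/(3.33) at time `2t` (the
world-lines are Brownian motions run at speed `2`, generator `Δ`). Consequences: the free
expectation `E[F(B_t)] = ∫ p(2t; X, Y) F(Y) dY` (`lintegral_worldLine_eq`), the bound
`p ≤ (4πt)^{-3N/2}` and `∫ p = 1`, the **`L² → L^∞` bound**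
`(e^{-tH_N} g)(X) ≤ E[g(B_t)] ≤ (4πt)^{-3N/4} ‖g‖₂` (Chung–Zhao Thm 3.10/3.17, `‖T_t‖_{2,∞} < ∞`;
`fkSemigroup_le_lintegral_worldLine`, `lintegral_worldLine_le_L2`), and the insensitivity of the
functional to null modifications of the observable (`fkSemigroup_congr_ae`).

Tree lemmas used: the product of measures with densities and the push-forward of a measure with
density under a measurable equivalence (`GaussianToolkit.pi_withDensity`,
`GaussianToolkit.map_withDensity_equiv`), the peak bound `gaussianPDFReal_le_peak`
(`GaussianSlabs`).

## References

* K. L. Chung, Z. Zhao, *From Brownian Motion to Schrödinger's Equation* (1995), (1.11), §3.3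
  (3.33) `p^D ≤ p ≤ (2πt)^{-d/2}`, Thm 3.10 (27) and Thm 3.17 (`T_t : L^p → L^∞`).
  [ChungZhao1995]
-/

noncomputable section

namespace Literature.MathematicalPhysics.QuantumManyBody.BoseGas

open MeasureTheory ProbabilityTheory Filter Set
open scoped ENNReal NNReal Topology
open Literature.Probability.Process
open Literature.MathematicalPhysics.QuantumFieldTheory.GaussianToolkit (pi_withDensity
  map_withDensity_equiv)
open Literature.Probability.Distributions (gaussianPDFReal_le_peak)

variable {N : ℕ}

/-! ### The Gaussian law of the world-lines at time `t` -/

/-- One coordinate: `√2 b_t ~ N(0, 2t)`. [folklore] -/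
theorem map_sqrt_two_mul_brownian (t : ℝ≥0) :
    preWienerMeasure.map (fun p : ℝ≥0 → ℝ => Real.sqrt 2 * brownian t p) =
      gaussianReal 0 (2 * t) := by
  have h : (fun p : ℝ≥0 → ℝ => Real.sqrt 2 * brownian t p) =
      (fun x : ℝ => Real.sqrt 2 * x) ∘ brownian t := rfl
  rw [h, ← Measure.map_map (measurable_const_mul _) (measurable_brownian t),
    (Literature.Probability.RandomPlanarGeometry.isPreBrownianReal_brownian.hasLaw_eval t).map_eq,
    gaussianReal_map_const_mul]
  congr 1
  · simp
  · ext
    simp [Real.sq_sqrt]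

/-- One particle, flat coordinates: `(√2 b_t(η k))_k ~ ⊗_k N(0, 2t)`. [folklore] -/
theorem map_pi_sqrt_two_mul_brownian (t : ℝ≥0) :
    (Measure.pi fun _ : Fin 3 => preWienerMeasure).map
      (fun (η : Fin 3 → ℝ≥0 → ℝ) (k : Fin 3) => Real.sqrt 2 * brownian t (η k)) =
      Measure.pi fun _ : Fin 3 => gaussianReal 0 (2 * t) := by
  haveI := Literature.Probability.RandomPlanarGeometry.isProbabilityMeasure_preWienerMeasure'
  rw [Measure.pi_map_pi (fun _ => ((measurable_brownian t).const_mul _).aemeasurable)]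
  simp_rw [map_sqrt_two_mul_brownian]

/-- The product Gaussian on `Fin 3 → ℝ` has the product density. [folklore] -/
theorem pi_gaussianReal_eq_withDensity {v : ℝ≥0} (hv : v ≠ 0) :
    (Measure.pi fun _ : Fin 3 => gaussianReal 0 v) =
      (volume : Measure (Fin 3 → ℝ)).withDensity fun y => ∏ k, gaussianPDF 0 v (y k) := by
  have h : (fun _ : Fin 3 => gaussianReal 0 v) =
      fun _ => (volume : Measure ℝ).withDensity (gaussianPDF 0 v) := by
    funext; exact gaussianReal_of_var_ne_zero 0 hv
  haveI : SigmaFinite ((volume : Measure ℝ).withDensity (gaussianPDF 0 v)) := by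
    rw [← gaussianReal_of_var_ne_zero 0 hv]
    infer_instance
  rw [h, pi_withDensity (fun _ : Fin 3 => (volume : Measure ℝ)) (fun _ => gaussianPDF 0 v)
    (fun _ => measurable_gaussianPDF 0 v)]
  rfl

/-- One particle, Euclidean coordinates: the law of `√2 b_t ∈ ℝ³` has density
`y ↦ ∏_k gaussianPDF 0 (2t) (y k)` with respect to Lebesgue measure on `ℝ³` (Mathlib:
`EuclideanSpace` volume = product Lebesgue under `toLp`). [folklore] -/
theorem map_toLp_sqrt_two_mul_brownian {t : ℝ≥0} (ht : t ≠ 0) :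
    (Measure.pi fun _ : Fin 3 => preWienerMeasure).map
      (fun η : Fin 3 → ℝ≥0 → ℝ => WithLp.toLp 2 (fun k : Fin 3 => Real.sqrt 2 * brownian t (η k))) =
      (volume : Measure Space).withDensity fun y => ∏ k, gaussianPDF 0 (2 * t) (y k) := by
  have hv : (2 : ℝ≥0) * t ≠ 0 := mul_ne_zero two_ne_zero ht
  have hmeas : Measurable fun (η : Fin 3 → ℝ≥0 → ℝ) (k : Fin 3) => Real.sqrt 2 * brownian t (η k) :=
    measurable_pi_lambda _ fun k => ((measurable_brownian t).const_mul _).comp (measurable_pi_apply k)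
  have h : (fun η : Fin 3 → ℝ≥0 → ℝ => WithLp.toLp 2 (fun k : Fin 3 => Real.sqrt 2 * brownian t (η k))) =
      (MeasurableEquiv.toLp 2 (Fin 3 → ℝ)) ∘
        fun (η : Fin 3 → ℝ≥0 → ℝ) (k : Fin 3) => Real.sqrt 2 * brownian t (η k) := rfl
  rw [h, ← Measure.map_map (MeasurableEquiv.measurable _) hmeas, map_pi_sqrt_two_mul_brownian,
    pi_gaussianReal_eq_withDensity hv, map_withDensity_equiv, MeasurableEquiv.coe_toLp,
    (PiLp.volume_preserving_toLp (Fin 3)).map_eq]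
  rfl

/-- All particles: the law of `√2 b_t ∈ (ℝ³)^N` (the displacement of the world-lines at time `t`)
has density `Y ↦ ∏ᵢ ∏ₖ gaussianPDF 0 (2t) (Y i k)`. [folklore] -/
theorem map_displacement {t : ℝ≥0} (ht : t ≠ 0) :
    (wienerPaths N).map (fun (ω : PathSpace N) (i : Fin N) =>
      WithLp.toLp 2 (fun k : Fin 3 => Real.sqrt 2 * brownian t (ω i k))) =
      (volume : Measure (Config N)).withDensity
        fun Y => ∏ i, ∏ k, gaussianPDF 0 (2 * t) (Y i k) := by
  haveI := Literature.Probability.RandomPlanarGeometry.isProbabilityMeasure_preWienerMeasure'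
  have hmeas : Measurable fun η : Fin 3 → ℝ≥0 → ℝ =>
      WithLp.toLp 2 (fun k : Fin 3 => Real.sqrt 2 * brownian t (η k)) :=
    (WithLp.measurable_toLp 2 _).comp (measurable_pi_lambda _ fun k =>
      ((measurable_brownian t).const_mul _).comp (measurable_pi_apply k))
  unfold wienerPaths
  rw [Measure.pi_map_pi (fun _ => hmeas.aemeasurable)]
  simp_rw [map_toLp_sqrt_two_mul_brownian ht]
  have hρ : Measurable fun y : Space => ∏ k, gaussianPDF 0 (2 * t) (y k) :=
    Finset.measurable_prod _ fun k _ => (measurable_gaussianPDF _ _).comp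
      ((measurable_pi_apply k).comp (WithLp.measurable_ofLp 2 _))
  haveI : SigmaFinite ((volume : Measure Space).withDensity
      fun y : Space => ∏ k, gaussianPDF 0 (2 * t) (y k)) := by
    rw [← map_toLp_sqrt_two_mul_brownian ht]
    infer_instance
  rw [pi_withDensity (fun _ : Fin N => (volume : Measure Space))
    (fun _ (y : Space) => ∏ k, gaussianPDF 0 (2 * t) (y k)) (fun _ => hρ)]
  rfl

/-- The world-line at time `t` is the starting point translated by the displacement. [folklore] -/
theorem worldLine_eq_add (X : Config N) (ω : PathSpace N) (t : ℝ≥0) :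
    worldLine X ω t = X + fun i => WithLp.toLp 2 (fun k : Fin 3 => Real.sqrt 2 * brownian t (ω i k)) :=
  rfl

/-- **The law of the world-lines at time `t > 0` is the Gaussian `N(X, 2t I_{3N})`**:
`(wienerPaths N).map (worldLine X · t)` has density `Y ↦ ∏ᵢ ∏ₖ gaussianPDF (X i k) (2t) (Y i k)`,
the free heat kernel `p(2t; X, Y)` (speed-`2` Brownian motion). Chung–Zhao (1995), (1.11) and
§3.3 (3.33). [cite: ChungZhao1995, (1.11) and §3.3 (3.33)] -/
theorem map_worldLine (X : Config N) {t : ℝ≥0} (ht : t ≠ 0) :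
    (wienerPaths N).map (fun ω : PathSpace N => worldLine X ω t) =
      (volume : Measure (Config N)).withDensity
        fun Y => ∏ i, ∏ k, gaussianPDF (X i k) (2 * t) (Y i k) := by
  have hmeas : Measurable fun (ω : PathSpace N) (i : Fin N) =>
      WithLp.toLp 2 (fun k : Fin 3 => Real.sqrt 2 * brownian t (ω i k)) :=
    measurable_pi_lambda _ fun i => (WithLp.measurable_toLp 2 _).comp
      (measurable_pi_lambda _ fun k => ((measurable_brownian t).const_mul _).comp
        ((measurable_pi_apply k).comp (measurable_pi_apply i)))
  have h : (fun ω : PathSpace N => worldLine X ω t) = (MeasurableEquiv.addLeft X) ∘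
      fun (ω : PathSpace N) (i : Fin N) =>
        WithLp.toLp 2 (fun k : Fin 3 => Real.sqrt 2 * brownian t (ω i k)) := by
    funext ω
    simp only [Function.comp_apply, MeasurableEquiv.coe_addLeft, worldLine_eq_add]
  rw [h, ← Measure.map_map (MeasurableEquiv.measurable _) hmeas, map_displacement ht,
    map_withDensity_equiv, MeasurableEquiv.coe_addLeft, map_add_left_eq_self]
  congr 1
  funext Y
  simp only [Function.comp_apply, MeasurableEquiv.symm_addLeft, MeasurableEquiv.coe_addLeft,
    Pi.add_apply, PiLp.add_apply, PiLp.neg_apply, Pi.neg_apply, gaussianPDF]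
  refine Finset.prod_congr rfl fun i _ => Finset.prod_congr rfl fun k _ => ?_
  rw [neg_add_eq_sub, gaussianPDFReal_sub, zero_add]

/-! ### The free heat kernel: measurability, bound, normalisation -/

/-- The free heat kernel `Y ↦ p(2t; X, Y)` is measurable. [folklore] -/
theorem measurable_heatKernel (X : Config N) (t : ℝ≥0) :
    Measurable fun Y : Config N => ∏ i, ∏ k, gaussianPDF (X i k) (2 * t) (Y i k) := by
  refine Finset.measurable_prod _ fun i _ => Finset.measurable_prod _ fun k _ => ?_
  exact (measurable_gaussianPDF _ _).comp ((measurable_pi_apply k).comp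
    ((WithLp.measurable_ofLp 2 _).comp (measurable_pi_apply i)))

/-- The free heat kernel is symmetric in `(X, Y)`. [folklore] -/
theorem heatKernel_symm (X Y : Config N) (t : ℝ≥0) :
    (∏ i, ∏ k, gaussianPDF (X i k) (2 * t) (Y i k)) =
      ∏ i, ∏ k, gaussianPDF (Y i k) (2 * t) (X i k) := by
  refine Finset.prod_congr rfl fun i _ => Finset.prod_congr rfl fun k _ => ?_
  simp only [gaussianPDF, gaussianPDFReal]
  congr 3
  ring

/-- **The free heat kernel is bounded**: `p(2t; X, Y) ≤ (4πt)^{-3N/2}`, here in the product form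
`∏ᵢ ∏ₖ (√(4πt))⁻¹`. Chung–Zhao (1995), (3.33). [cite: ChungZhao1995, §3.3 (3.33)] -/
theorem heatKernel_le (X Y : Config N) (t : ℝ≥0) :
    (∏ i, ∏ k, gaussianPDF (X i k) (2 * t) (Y i k)) ≤
      ∏ _i : Fin N, ∏ _k : Fin 3, ENNReal.ofReal (Real.sqrt (2 * Real.pi * (2 * t)))⁻¹ := by
  refine Finset.prod_le_prod' fun i _ => Finset.prod_le_prod' fun k _ => ?_
  rw [gaussianPDF]
  have h1 := gaussianPDFReal_le_peak (X i k) (2 * t) (Y i k)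
  push_cast at h1
  exact ENNReal.ofReal_le_ofReal h1

/-- **The free expectation as an integral against the heat kernel**: for measurable
`F : (ℝ³)^N → [0, ∞]` and `t > 0`, `E[F(B_t)] = ∫ p(2t; X, Y) F(Y) dY`. [folklore] -/
theorem lintegral_worldLine_eq (X : Config N) {t : ℝ≥0} (ht : t ≠ 0) {F : Config N → ℝ≥0∞}
    (hF : Measurable F) :
    ∫⁻ ω, F (worldLine X ω t) ∂wienerPaths N =
      ∫⁻ Y : Config N, (∏ i, ∏ k, gaussianPDF (X i k) (2 * t) (Y i k)) * F Y := by
  rw [← lintegral_map hF (measurable_worldLine X t), map_worldLine X ht,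
    lintegral_withDensity_eq_lintegral_mul _ (measurable_heatKernel X t) hF]
  rfl

/-- **The heat kernel has total mass one**: `∫ p(2t; X, Y) dY = 1` (`t > 0`). [folklore] -/
theorem lintegral_heatKernel (X : Config N) {t : ℝ≥0} (ht : t ≠ 0) :
    ∫⁻ Y : Config N, (∏ i, ∏ k, gaussianPDF (X i k) (2 * t) (Y i k)) = 1 := by
  have h := lintegral_worldLine_eq X ht (F := fun _ => 1) measurable_const
  simp only [mul_one, lintegral_const, measure_univ] at h
  exact h.symm

/-- The law of `B_t` (`t > 0`) is absolutely continuous with respect to Lebesgue measure.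
[folklore] -/
theorem map_worldLine_absolutelyContinuous (X : Config N) {t : ℝ≥0} (ht : t ≠ 0) :
    (wienerPaths N).map (fun ω : PathSpace N => worldLine X ω t) ≪ volume := by
  rw [map_worldLine X ht]
  exact withDensity_absolutelyContinuous _ _

/-- **A null modification of the observable does not change the free expectation** (`t > 0`: the
law of `B_t` is absolutely continuous). [folklore] -/
theorem lintegral_worldLine_congr_ae (X : Config N) {t : ℝ≥0} (ht : t ≠ 0)
    {F G : Config N → ℝ≥0∞} (hF : AEMeasurable F volume) (h : F =ᵐ[volume] G) :
    ∫⁻ ω, F (worldLine X ω t) ∂wienerPaths N = ∫⁻ ω, G (worldLine X ω t) ∂wienerPaths N := by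
  have hac := map_worldLine_absolutelyContinuous X ht
  have hF' : AEMeasurable F ((wienerPaths N).map fun ω : PathSpace N => worldLine X ω t) :=
    hF.mono_ac hac
  have hG' : AEMeasurable G ((wienerPaths N).map fun ω : PathSpace N => worldLine X ω t) :=
    (hF.congr h).mono_ac hac
  rw [← lintegral_map' hF' (measurable_worldLine X t).aemeasurable,
    ← lintegral_map' hG' (measurable_worldLine X t).aemeasurable]
  exact lintegral_congr_ae (hac.ae_eq h)

/-- A null modification of the observable is invisible along the world-lines at time `t > 0`:
`g = g'` a.e. implies `g(B_t) = g'(B_t)` almost surely. [folklore] -/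
theorem comp_worldLine_ae_eq (X : Config N) {t : ℝ≥0} (ht : t ≠ 0) {β : Type*}
    {g g' : Config N → β} (h : g =ᵐ[volume] g') :
    (fun ω : PathSpace N => g (worldLine X ω t)) =ᵐ[wienerPaths N]
      fun ω => g' (worldLine X ω t) :=
  ae_of_ae_map (measurable_worldLine X t).aemeasurable
    ((map_worldLine_absolutelyContinuous X ht).ae_eq h)

/-! ### The `L² → L^∞` bound -/

/-- `∫ p² ≤ sup p · ∫ p = sup p`: the heat kernel is square integrable with
`∫ p(2t; X, ·)² ≤ (4πt)^{-3N/2}`. [folklore] -/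
theorem lintegral_heatKernel_sq_le (X : Config N) {t : ℝ≥0} (ht : t ≠ 0) :
    ∫⁻ Y : Config N, (∏ i, ∏ k, gaussianPDF (X i k) (2 * t) (Y i k)) ^ (2 : ℝ) ≤
      ∏ _i : Fin N, ∏ _k : Fin 3, ENNReal.ofReal (Real.sqrt (2 * Real.pi * (2 * t)))⁻¹ := by
  calc ∫⁻ Y : Config N, (∏ i, ∏ k, gaussianPDF (X i k) (2 * t) (Y i k)) ^ (2 : ℝ)
      ≤ ∫⁻ Y : Config N, (∏ _i : Fin N, ∏ _k : Fin 3,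
          ENNReal.ofReal (Real.sqrt (2 * Real.pi * (2 * t)))⁻¹) *
          ∏ i, ∏ k, gaussianPDF (X i k) (2 * t) (Y i k) := by
        refine lintegral_mono fun Y => ?_
        rw [ENNReal.rpow_two, sq]
        exact mul_le_mul' (heatKernel_le X Y t) le_rfl
    _ = ∏ _i : Fin N, ∏ _k : Fin 3, ENNReal.ofReal (Real.sqrt (2 * Real.pi * (2 * t)))⁻¹ := by
        rw [lintegral_const_mul _ (measurable_heatKernel X t), lintegral_heatKernel X ht, mul_one]

/-- **The free `L² → L^∞` bound**: for measurable `g ≥ 0` and `t > 0`,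
`E[g(B_t)] = ∫ p g ≤ ‖p(2t; X, ·)‖₂ ‖g‖₂ ≤ (4πt)^{-3N/4} ‖g‖₂` (Cauchy–Schwarz). Chung–Zhao (1995),
Thm 3.10 (27)/Thm 3.17 (`‖T_t‖_{2,∞} < ∞`). [cite: ChungZhao1995, Thm 3.10 and Thm 3.17] -/
theorem lintegral_worldLine_le_L2 (X : Config N) {t : ℝ≥0} (ht : t ≠ 0) {g : Config N → ℝ≥0∞}
    (hg : Measurable g) :
    ∫⁻ ω, g (worldLine X ω t) ∂wienerPaths N ≤
      (∏ _i : Fin N, ∏ _k : Fin 3, ENNReal.ofReal (Real.sqrt (2 * Real.pi * (2 * t)))⁻¹) ^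
          (1 / 2 : ℝ) * (∫⁻ Y, g Y ^ (2 : ℝ)) ^ (1 / 2 : ℝ) := by
  rw [lintegral_worldLine_eq X ht hg]
  calc ∫⁻ Y : Config N, (∏ i, ∏ k, gaussianPDF (X i k) (2 * t) (Y i k)) * g Y
      ≤ (∫⁻ Y : Config N, (∏ i, ∏ k, gaussianPDF (X i k) (2 * t) (Y i k)) ^ (2 : ℝ)) ^ (1 / 2 : ℝ) *
          (∫⁻ Y, g Y ^ (2 : ℝ)) ^ (1 / 2 : ℝ) :=
        ENNReal.lintegral_mul_le_Lp_mul_Lq volume Real.HolderConjugate.two_two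
          (measurable_heatKernel X t).aemeasurable hg.aemeasurable
    _ ≤ _ := by
        gcongr
        exact lintegral_heatKernel_sq_le X ht

/-- **The Feynman–Kac functional is dominated by the free expectation** (weights `≤ 1`):
`(e^{-tH_N} g)(X) ≤ E[g(B_t)]`. Chung–Zhao (1995), (3.33) `p^D ≤ p`.
[cite: ChungZhao1995, §3.3 (3.33)] -/
theorem fkSemigroup_le_lintegral_worldLine (v : ℝ → ℝ≥0∞) (L t : ℝ) (g : Config N → ℝ≥0∞)
    (X : Config N) :
    fkSemigroup v L t g X ≤ ∫⁻ ω, g (worldLine X ω t.toNNReal) ∂wienerPaths N :=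
  lintegral_mono fun ω => by
    calc fkWeight v L t X ω * g (worldLine X ω t.toNNReal) ≤ 1 * g (worldLine X ω t.toNNReal) :=
          mul_le_mul' (fkWeight_le_one v L t X ω) le_rfl
      _ = _ := one_mul _

/-- **`L² → L^∞` bound for the Feynman–Kac functional**: for `t > 0` and measurable `g ≥ 0`,
`(e^{-tH_N} g)(X) ≤ (4πt)^{-3N/4} ‖g‖₂`, uniformly in `X`. Chung–Zhao (1995), Thm 3.17
(`T_t` is bounded from `L²(D)` to `L^∞(D)`). [cite: ChungZhao1995, Thm 3.17] -/
theorem fkSemigroup_le_L2 (v : ℝ → ℝ≥0∞) (L : ℝ) {t : ℝ} (ht : 0 < t) {g : Config N → ℝ≥0∞}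
    (hg : Measurable g) (X : Config N) :
    fkSemigroup v L t g X ≤
      (∏ _i : Fin N, ∏ _k : Fin 3, ENNReal.ofReal (Real.sqrt (2 * Real.pi * (2 * t.toNNReal)))⁻¹) ^
          (1 / 2 : ℝ) * (∫⁻ Y, g Y ^ (2 : ℝ)) ^ (1 / 2 : ℝ) :=
  (fkSemigroup_le_lintegral_worldLine v L t g X).trans
    (lintegral_worldLine_le_L2 X (by simpa using ht) hg)

/-- In particular the Feynman–Kac functional of an `L²` observable is finite at every point
(`t > 0`). [folklore] -/
theorem fkSemigroup_lt_top (v : ℝ → ℝ≥0∞) (L : ℝ) {t : ℝ} (ht : 0 < t) {g : Config N → ℝ≥0∞}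
    (hg : Measurable g) (hg2 : ∫⁻ Y, g Y ^ (2 : ℝ) ≠ ⊤) (X : Config N) :
    fkSemigroup v L t g X < ⊤ := by
  refine (fkSemigroup_le_L2 v L ht hg X).trans_lt (ENNReal.mul_lt_top ?_ ?_)
  · refine ENNReal.rpow_lt_top_of_nonneg (by norm_num) (ne_of_lt ?_)
    refine ENNReal.prod_lt_top fun i _ => ENNReal.prod_lt_top fun k _ => ?_
    exact ENNReal.ofReal_lt_top
  · exact ENNReal.rpow_lt_top_of_nonneg (by norm_num) hg2

/-- **A null modification of the observable does not change the Feynman–Kac functional**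
(`t > 0`). [folklore] -/
theorem fkSemigroup_congr_ae (v : ℝ → ℝ≥0∞) (L : ℝ) {t : ℝ} (ht : 0 < t)
    {g g' : Config N → ℝ≥0∞} (h : g =ᵐ[volume] g') (X : Config N) :
    fkSemigroup v L t g X = fkSemigroup v L t g' X := by
  refine lintegral_congr_ae ?_
  filter_upwards [comp_worldLine_ae_eq X (t := t.toNNReal) (by simpa using ht) h] with ω hω
  rw [hω]

end Literature.MathematicalPhysics.QuantumManyBody.BoseGas

end
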